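import HarnessLib
import Summits.QuantumFields.YangMills.Theses.BalabanLadder
import Summits.QuantumFields.YangMills.Theorems.BalabanLadderUVSeamRecStubTransport
import Summits.QuantumFields.YangMills.Theorems.BalabanLadderUVSeamRecUnitTransfer
import Summits.QuantumFields.YangMills.Theorems.BalabanLadderUVSeamRecCeilingsResponseMomentsUnit
import Summits.QuantumFields.YangMills.Theorems.BalabanLadderUVSeamRecResponseMomentsRecentring
import Summits.QuantumFields.YangMills.Theorems.LangevinControlUVOSLegsFromFemtoAndGapStubAssemblyPlaneStrings
import Literature.MathematicalPhysics.QuantumLattice.RepLieAlgebraUnitary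

/-! # LINE «extremal-coldwall» (cold-wall extremality) for crux `UVSeamRec` (stmt-QuantumFields-20043) — ideator ym-idea-10 g2 (lens RESCUER), 2026-08-28

A RESCUED skeleton (crux workfile, not a registry write; the owner's pen decides).  CORPSES and located deaths (STATE-OF-THE-CRUX-20043, LANE-B g6–g9,
LEAD #50, tempered-d1/d2, this seat's K6): every (β)-architecture line (v6 β-cl, v7c WCL, v8c UCR, v8d GUCR, g0 `coldwall_pure`, g0 `guarded_classical_gap`)
routes the registered (RM) text through TWO posited intermediate objects — a REFERENCE value `p` with a posited RATE (K2: `p ≡ 2`/`p ≡ N` refuted by the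
thermal floor, `not_pureSplitCl_const_two` p592745, `not_dirichletRate_const_two` p592923; the repaired (DR) `DirichletRateSU2` is a separate open stub) and
a CARRIER with a posited law under the torus state ((GD)/(EC): bare-β normalised — K6 «bare-coupling carrier», inconsistent with asymptotic freedom at the
top of the window; large-field halves: K4/K5 flat-penetration floors for every `∀η` rarity clause).

THE DODGE — a different organ altogether: a SIGN.  NEW LEVER (CWX) «COLD-WALL EXTREMALITY»: among ALL exteriors `η` of the Dirichlet cube
`Λ = x − (R+1) + [0, 2R+2]⁴`, the cold wall `η ≡ 1` MAXIMISES the expected centre plaquette: `kerE^η_{β,Λ}(plane q x) ≤ kerE^𝟙_{β,Λ}(plane q x)` on the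
window.  (A correlation inequality of Griffiths type for the boundary condition; EXACT for the lattice GFF — conditioning shifts the mean, not the
covariance, so the response is the classical one `≥ 0`, seam-s2 `GaussianCalibrationSplit`; classical `β = ∞`: trivial; pure-gauge exteriors: equality;
the cold wall is a CRITICAL point among exteriors by charge conjugation `η ↦ η̄`, and a local MAXIMUM at one loop in EVERY direction:
`F''(0) = −β·Cov(P_c, P_b) + β²·Cov(P_c, J_b²)`, both terms `≤ 0` by Wick (`Cov(X², Y²) = 2Cov(X,Y)² ≥ 0`); away from the cold wall the response is
classical `× (1 + O(g²(R)))` and the classical response is `≥ 0` (`classicalResponse_nonneg`).)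
WHAT THE SIGN BUYS (kernel-checked below): with `r_i := kerE^𝟙 − kerE^{U}_i ≥ 0` the absolute value in (RM) OPENS, the reference value is no longer posited
but DERIVED — `p q β :=` the torus plaquette mean on the canonical admissible torus `L†(β) = 4⌈ℓ₁/uRec β⌉ + 8` — and the Dirichlet finite-size law
`0 ≤ kerE^𝟙_{β,R} − p q β ≤ C₁(e^B − 1)/R⁴` (the content of (DR), two-sided!) becomes a COROLLARY of one-site (XM) + torus DLR
(`ResponsePinning.torusE_plane_eq_torusE_kerE`) + translation invariance (`torusE_plane_eq_wilsonTorusMean`): K2 cannot bite (nothing about `p` is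
posited), and the line needs NO carrier, NO rarity clause, NO bare-β normalisation (K4/K5/K6 have no organ to bite).  The measure side is ONE stub in
RESPONSE UNITS:
* `stub_defectMoments` (XM) «ONE-SIDED joint exponential moments of the cold-wall DEFECT» — `⟨exp(Σ_{i∈T} (R⁴/C₁)(kerE^𝟙_i − kerE^{U}_i))⟩_{2L+1,β} ≤ e^{B·#T}`
  on odd tori, window, cyclically separated families.  It is implied by (RM)-with-cold-wall-reference and is WEAKER (no absolute value: exteriors that
  order the centre MORE than the cold wall — if any — cost nothing); AF-consistent ((R⁴/C₁)·defect `≍ g²(R)/C₁ ≤ g²(ℓ₁)/C₁`); GFF calibration: the defect is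
  `(R⁴/C₁)×`(harmonic centre flux)², whose joint exponential moments are seam-s2's `GaussianCalibrationLaw`.
* `stub_coldWallExtremal` (CWX) — the sign, for every exterior, on the window (`β ≥ β₀`, `1 ≤ R`, `R·uRec β ≤ ℓ₀`).
* `stub_floorsEngine` — BYTE-IDENTICAL to v5(α)/v7c/v8c/v8d/coldwall_pure (NT desk, 19353); not rescued here.
TRUTH-IN-LABELLING (K1): measure stubs WITHOUT the idle `UV →`; `UVSeamRec_of` keeps it, unconsumed, visibly.

THEOREMS (kernel-checked): `coldWall_pin` (CWX ∧ one-site XM ⇒ `|kerE^𝟙_{β,R}(plane q x) − p q β| ≤ C₁(e^B−1)/R⁴`), `responseMomentsOdd6SU2_of_extremal`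
(CWX ∧ XM ⇒ the registered (RM) body with `B ↦ B + (e^B − 1)`, `a := uRec`, `c := 1`, via `ResponsePinning.torusE_exp_sum_response_recentre`),
`stub_responseMomentsOdd6` (registered text verbatim), `stub_ceilings`, `stub_transport`, `UVSeamRec_of`.
Stubs (sorries) = {`stub_coldWallExtremal`, `stub_defectMoments`, `stub_floorsEngine`}.  bears_on: LADDER-YM rung R2d.

INSTRUMENT ROW (refutes CWX within one engine run): Dirichlet cubes `R = 1,2,3` at β_std ∈ {2.3, 2.5, 2.7}: centre-plaquette mean under (a) cold wall,
(b) Haar-random («hot») wall, (c) abelian-flux walls of flux `k·2π/(2R+3)²`, (d) a one-link-twisted cold wall; CWX predicts (a) is the maximum in every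
case (differences `≍ R⁻⁴·flux²/…` for (c), `O(1)` for (b)); a single exterior beating the cold wall by more than the statistical error kills the line.

HONEST FRAMING: a re-cut of OPEN conditional content plus kernel-checked glue; no correlation inequality of this type is known for non-abelian gauge
theories (the bet is stated as a stub, with its one-loop evidence); nothing of E0′, NT or a gap is claimed; not Clay; no summit is proved by a line.
-/

namespace Summit.QuantumFields.YangMills.Cruxes.UVSeamRec.ExtremalColdWall

open Literature.MathematicalPhysics.QuantumFieldTheory
open Summit.QuantumFields.YangMills.Cruxes.OSLegsFromFemtoAndGap.DlrCollarTransfer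
open Filter Topology
open scoped SchwartzMap
open Literature.MathematicalPhysics.QuantumLattice (thetaTest LGConfig fundamentalLatticeRep)
open Summit.QuantumFields.YangMills.Cruxes.UVSeamRec.ResponsePinning
  (torusE_exp_sum_response_recentre torusE_abs_sub_le_of_expMoment torusE_plane_eq_torusE_kerE torusE_add' torusE_const
   abs_torusE_sub_le_of_forall)
open Summit.QuantumFields.YangMills.Cruxes.UVSeamRec.TemperedResponse (continuous_kerE_plane abs_kerE_plane_le)
open Summit.QuantumFields.YangMills.Theorems.OSLegsFromFemtoAndGap (torusE_plane_eq_wilsonTorusMean)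

/-- The FUNDAMENTAL (defining) lattice representation of `SU(2)` (as v4-F/v5(α)). -/
abbrev rF : LatticeRep (Matrix.specialUnitaryGroup (Fin 2) ℂ) :=
  Literature.MathematicalPhysics.QuantumLattice.fundamentalLatticeRep 2

/-- the unit of record (abbreviation used only inside this skeleton). -/
noncomputable abbrev uRec : ℝ → ℝ := fun β => Real.exp (Summit.QuantumFields.YangMills.Theorems.FemtoTransferGap.sizeLog β 1)

/-- The canonical admissible torus half-side at coupling `β` for the window `R·uRec β ≤ ℓ₁`: `L†(β) = 4⌈ℓ₁/uRec β⌉ + 8` (so `4R + 8 ≤ L†(β)` for every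
admissible radius `R`). -/
noncomputable def Ldag (ℓ₁ : ℝ) (β : ℝ) : ℕ := 4 * ⌈ℓ₁ / Transport.uRec β⌉₊ + 8

/-- The DERIVED reference value: the torus plaquette mean on the canonical admissible torus. -/
noncomputable def pRef (ℓ₁ : ℝ) (q : Fin 4 × Fin 4) (β : ℝ) : ℝ :=
  letI : MeasurableSpace (Matrix.specialUnitaryGroup (Fin 2) ℂ) := borel _
  haveI : BorelSpace (Matrix.specialUnitaryGroup (Fin 2) ℂ) := ⟨rfl⟩
  torusE (Matrix.specialUnitaryGroup (Fin 2) ℂ) rF β (Ldag ℓ₁ β) (plane (Matrix.specialUnitaryGroup (Fin 2) ℂ) rF q 0)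

theorem uRec_pos (β : ℝ) : 0 < Transport.uRec β := Real.exp_pos _

theorem le_Ldag {ℓ₁ β : ℝ} {R : ℕ} (hRa : (R : ℝ) * Transport.uRec β ≤ ℓ₁) : 4 * R + 8 ≤ Ldag ℓ₁ β := by
  have h1 : (R : ℝ) ≤ ℓ₁ / Transport.uRec β := (le_div_iff₀ (uRec_pos β)).2 hRa
  have h2 : (R : ℝ) ≤ (⌈ℓ₁ / Transport.uRec β⌉₊ : ℕ) := h1.trans (Nat.le_ceil _)
  have h3 : R ≤ ⌈ℓ₁ / Transport.uRec β⌉₊ := by exact_mod_cast h2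
  unfold Ldag
  omega

/-- D0 (iso-transport) — PROVED (`Transport.stub_transport_proved`, p412513); text = v5(α) verbatim. -/
theorem stub_transport :
    (letI : MeasurableSpace (Matrix.specialUnitaryGroup (Fin 2) ℂ) := borel _
     haveI : BorelSpace (Matrix.specialUnitaryGroup (Fin 2) ℂ) := ⟨rfl⟩
     ∃ r₂ : LatticeRep (Matrix.specialUnitaryGroup (Fin 2) ℂ),
       LowerBounds (Matrix.specialUnitaryGroup (Fin 2) ℂ) r₂ uRec ∧ MomentBounds6 (Matrix.specialUnitaryGroup (Fin 2) ℂ) r₂ uRec) →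
    ∀ (G : Type) [Group G] [TopologicalSpace G] [IsTopologicalGroup G] [CompactSpace G],
      IsCompactSimpleLieGroup G → Nonempty (G ≃ₜ* Matrix.specialUnitaryGroup (Fin 2) ℂ) →
      letI : MeasurableSpace G := borel G; haveI : BorelSpace G := ⟨rfl⟩;
      ∃ r : LatticeRep G, LowerBounds G r uRec ∧ MomentBounds6 G r uRec := by
  exact Summit.QuantumFields.YangMills.Cruxes.UVSeamRec.Transport.stub_transport_proved

/-- STUB (CWX) «COLD-WALL EXTREMALITY» (L/XL; the NEW LEVER — a boundary-condition correlation inequality): thresholds `β₀` and `ℓ₀ > 0` such that for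
`β ≥ β₀`, `1 ≤ R`, `R·uRec β ≤ ℓ₀`, every plane `q`, site `x` and EVERY exterior `η`, the expected centre plaquette of the Dirichlet cube of side `2R+3`
around `x` is maximised by the cold wall: `kerE^η(plane q x) ≤ kerE^𝟙(plane q x)`.  Evidence: exact for the lattice GFF (response = classical response
`≥ 0`, seam-s2); classical limit trivial; pure-gauge exteriors give equality (gauge covariance of `kerE`); the cold wall is critical by `η ↦ η̄` and a
one-loop local maximum in every direction (`F''(0) = −βCov(P_c,P_b) + β²Cov(P_c,J_b²)`, both `≤ 0` by Wick); far from the cold wall the response is the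
classical one `× (1 + O(g²))`, and `classicalResponse ≥ 0`; at strong coupling the leading character-expansion surfaces carry positive Bessel
coefficients with boundary characters maximised at `η = 1` (not used: the stub is on the window).  No rarity, no size, no reference: K2/K4/K5/K6 have no
organ here.  Why it might fail: no Griffiths/FKG-type inequality is known for non-abelian lattice gauge theory; a purely quantum (two-loop) NEGATIVE
response for an exterior family whose classical response vanishes identically at the centre (symmetric «hedgehog» data, centre-flat near-minimisers)
would break the sign at large but finite β — the one-loop second variation is `−Θ(R⁻⁸/β)` per unit boundary perturbation, so such a family must win at
relative order `g²` against a non-degenerate negative-definite form.  INSTRUMENT: Dirichlet cubes `R = 1,2,3`, β_std ∈ {2.3, 2.5, 2.7}: centre-plaquette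
mean under cold / hot (Haar) / abelian-flux / one-link-twisted walls — any exterior beating the cold wall beyond statistical error kills the line. -/
theorem stub_coldWallExtremal :
    ∃ (β₀ ℓ₀ : ℝ), 0 < ℓ₀ ∧
      ∀ β : ℝ, β₀ ≤ β → ∀ R : ℕ, 1 ≤ R → (R : ℝ) * Transport.uRec β ≤ ℓ₀ →
      ∀ (q : Fin 4 × Fin 4) (x : Fin 4 → ℤ), q.1 < q.2 → ∀ η : LGConfig 4 (Matrix.specialUnitaryGroup (Fin 2) ℂ),
        kerE (Matrix.specialUnitaryGroup (Fin 2) ℂ) (fundamentalLatticeRep 2) β (fun k => x k - (R + 1)) (2 * R + 3) η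
            (plane (Matrix.specialUnitaryGroup (Fin 2) ℂ) (fundamentalLatticeRep 2) q x) ≤
          kerE (Matrix.specialUnitaryGroup (Fin 2) ℂ) (fundamentalLatticeRep 2) β (fun k => x k - (R + 1)) (2 * R + 3) 1
            (plane (Matrix.specialUnitaryGroup (Fin 2) ℂ) (fundamentalLatticeRep 2) q x) := by
  sorry

/-- STUB (XM) «ONE-SIDED JOINT EXPONENTIAL MOMENTS OF THE COLD-WALL DEFECT, in response units» (XL; HARDEST; the whole measure-side size content of the
line): constants `C₁ > 0`, `ℓ₁ > 0`, `B`, `β₁` such that for `β ≥ β₁`, on every odd torus `2L+1` with `4R+8 ≤ L`, every cyclically `2R+4`-separated family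
on the window `R·uRec β ≤ ℓ₁` and every sub-family `T`:
`⟨exp(Σ_{i∈T} (R⁴/C₁)·(kerE^𝟙_i(plane) − kerE^{U}_i(plane)))⟩_{2L+1,β} ≤ exp(B·#T)`.  NO absolute value (exteriors ordering the centre more than the cold
wall, if any, are free), NO reference value, NO carrier, NO rarity clause: the torus state is asked directly for the extensive law of the physically
signed defect, in RESPONSE units (AF-consistent: `(R⁴/C₁)·defect ≍ g²(R)/C₁ ≤ g²(ℓ₁)/C₁`, K6 cannot bite).  Implied by (RM) referenced to the cold wall;
with (CWX) it implies (RM) (glue below) AND the two-sided Dirichlet finite-size law `0 ≤ kerE^𝟙_{β,R} − ⟨P⟩ ≤ C₁(e^B−1)/R⁴` (`coldWall_pin`: (DR)'s content is a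
corollary, not a stub).  Gaussian calibration: defect = `(R⁴/C₁)×`(harmonic centre flux)², joint exponential moments = seam-s2 `GaussianCalibrationLaw`
(PROVED for the GFF; operator-norm constant).  Semiclassics: torons give defect `≲ (R/L)⁴·O(1)`; instantons of size `ρ ≥ R` give defect `≍ R⁴ρ⁴/(ρ²+R²)⁴/C₁ ≤ 1/C₁`
— bounded pointwise contribution.  Why it might fail: it is a UV-stability statement of E0′ type for a centre-plaquette statistic uniform in the torus
size (the extensive joint law over separated cubes is the multiscale-cluster-expansion content of every (RM)-currency line; LEAD g10: no
finite-dimensional special case); a heavy upper tail of the defect (exteriors disordering the centre by `O(1)` with probability not exponentially small in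
`R⁴/C₁`) would make the exponential moment infinite.  INSTRUMENT: torus β_std 2.5–2.85, `L = 24–32`, `R = 2..5`: histogram of `(R⁴/C₁)(kerE^𝟙 − kerE^{U})`
over sampled exteriors `U` (kernel means by inner MC), single-cube `log⟨exp⟩` vs `C₁`, and the pair excess for two cubes at separation `2R+4`. -/
theorem stub_defectMoments :
    letI : MeasurableSpace (Matrix.specialUnitaryGroup (Fin 2) ℂ) := borel _
    haveI : BorelSpace (Matrix.specialUnitaryGroup (Fin 2) ℂ) := ⟨rfl⟩
    ∃ (C₁ B β₁ ℓ₁ : ℝ), 0 < C₁ ∧ 0 < ℓ₁ ∧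
      ∀ β : ℝ, β₁ ≤ β → ∀ (L n : ℕ) (q : Fin n → Fin 4 × Fin 4) (x : Fin n → (Fin 4 → ℤ)) (R : ℕ),
      (∀ i, (q i).1 < (q i).2) → 1 ≤ R → (R : ℝ) * Transport.uRec β ≤ ℓ₁ → 4 * R + 8 ≤ L →
      (∀ i j : Fin n, i ≠ j → ∃ k : Fin 4,
        (2 * (R : ℤ) + 4) ≤ |((((x i k - x j k : ℤ) : ZMod (2 * L + 1))).valMinAbs : ℤ)|) →
      ∀ T : Finset (Fin n),
        torusE (Matrix.specialUnitaryGroup (Fin 2) ℂ) (fundamentalLatticeRep 2) β L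
          (fun U => Real.exp (∑ i ∈ T, (R : ℝ) ^ 4 / C₁ *
            (kerE (Matrix.specialUnitaryGroup (Fin 2) ℂ) (fundamentalLatticeRep 2) β (fun k => x i k - (R + 1)) (2 * R + 3) 1
                (plane (Matrix.specialUnitaryGroup (Fin 2) ℂ) (fundamentalLatticeRep 2) (q i) (x i)) -
              kerE (Matrix.specialUnitaryGroup (Fin 2) ℂ) (fundamentalLatticeRep 2) β (fun k => x i k - (R + 1)) (2 * R + 3) U
                (plane (Matrix.specialUnitaryGroup (Fin 2) ℂ) (fundamentalLatticeRep 2) (q i) (x i))))) ≤ Real.exp (B * T.card) := by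
  sorry

/-- **PINNING FROM THE SIGN** (proved): under (CWX) at `(β, R)` and the ONE-SITE case of (XM) at `(β, R)` on the canonical torus `L†(β)`, the cold-wall
kernel mean is within `C₁(e^B − 1)/R⁴` of the DERIVED reference value `pRef ℓ₁ q β` — the Dirichlet finite-size law as a corollary (one-site moment bound
`ResponsePinning.torusE_abs_sub_le_of_expMoment`, torus DLR `torusE_plane_eq_torusE_kerE`, translation invariance `torusE_plane_eq_wilsonTorusMean`). -/
theorem coldWall_pin {C₁ B ℓ₁ β : ℝ} (hC₁ : 0 < C₁) {R : ℕ} (hR : 1 ≤ R) (hRa : (R : ℝ) * Transport.uRec β ≤ ℓ₁)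
    (q : Fin 4 × Fin 4) (x : Fin 4 → ℤ)
    (hCW : ∀ η : LGConfig 4 (Matrix.specialUnitaryGroup (Fin 2) ℂ),
        kerE (Matrix.specialUnitaryGroup (Fin 2) ℂ) (fundamentalLatticeRep 2) β (fun k => x k - (R + 1)) (2 * R + 3) η
            (plane (Matrix.specialUnitaryGroup (Fin 2) ℂ) (fundamentalLatticeRep 2) q x) ≤
          kerE (Matrix.specialUnitaryGroup (Fin 2) ℂ) (fundamentalLatticeRep 2) β (fun k => x k - (R + 1)) (2 * R + 3) 1
            (plane (Matrix.specialUnitaryGroup (Fin 2) ℂ) (fundamentalLatticeRep 2) q x))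
    (hX1 : letI : MeasurableSpace (Matrix.specialUnitaryGroup (Fin 2) ℂ) := borel _
      haveI : BorelSpace (Matrix.specialUnitaryGroup (Fin 2) ℂ) := ⟨rfl⟩
      torusE (Matrix.specialUnitaryGroup (Fin 2) ℂ) (fundamentalLatticeRep 2) β (Ldag ℓ₁ β)
          (fun U => Real.exp ((R : ℝ) ^ 4 / C₁ *
            (kerE (Matrix.specialUnitaryGroup (Fin 2) ℂ) (fundamentalLatticeRep 2) β (fun k => x k - (R + 1)) (2 * R + 3) 1
                (plane (Matrix.specialUnitaryGroup (Fin 2) ℂ) (fundamentalLatticeRep 2) q x) -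
              kerE (Matrix.specialUnitaryGroup (Fin 2) ℂ) (fundamentalLatticeRep 2) β (fun k => x k - (R + 1)) (2 * R + 3) U
                (plane (Matrix.specialUnitaryGroup (Fin 2) ℂ) (fundamentalLatticeRep 2) q x)))) ≤ Real.exp B) :
    |kerE (Matrix.specialUnitaryGroup (Fin 2) ℂ) (fundamentalLatticeRep 2) β (fun k => x k - (R + 1)) (2 * R + 3) 1
        (plane (Matrix.specialUnitaryGroup (Fin 2) ℂ) (fundamentalLatticeRep 2) q x) - pRef ℓ₁ q β| ≤ C₁ * (Real.exp B - 1) / (R : ℝ) ^ 4 := by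
  letI : MeasurableSpace (Matrix.specialUnitaryGroup (Fin 2) ℂ) := borel _
  haveI : BorelSpace (Matrix.specialUnitaryGroup (Fin 2) ℂ) := ⟨rfl⟩
  set L : ℕ := Ldag ℓ₁ β with hLdef
  have hL : 4 * R + 8 ≤ L := le_Ldag hRa
  set K1 : ℝ := kerE (Matrix.specialUnitaryGroup (Fin 2) ℂ) (fundamentalLatticeRep 2) β (fun k => x k - (R + 1)) (2 * R + 3) 1
        (plane (Matrix.specialUnitaryGroup (Fin 2) ℂ) (fundamentalLatticeRep 2) q x) with hK1
  set k : LGConfig 4 (Matrix.specialUnitaryGroup (Fin 2) ℂ) → ℝ := fun U =>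
    kerE (Matrix.specialUnitaryGroup (Fin 2) ℂ) (fundamentalLatticeRep 2) β (fun k => x k - (R + 1)) (2 * R + 3) U
        (plane (Matrix.specialUnitaryGroup (Fin 2) ℂ) (fundamentalLatticeRep 2) q x) with hk
  have hkc : Continuous k := continuous_kerE_plane rF β _ _ q x
  have hR0 : (0 : ℝ) < R := by exact_mod_cast (show 0 < R by omega)
  have hlam : 0 < (R : ℝ) ^ 4 / C₁ := by positivity
  -- the signed integrand equals the absolute one (CWX)
  have hpt : ∀ U, (R : ℝ) ^ 4 / C₁ * (K1 - k U) = (R : ℝ) ^ 4 / C₁ * |k U - K1| := fun U => by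
    rw [abs_sub_comm, abs_of_nonneg (sub_nonneg.2 (hCW U))]
  have h1 : torusE (Matrix.specialUnitaryGroup (Fin 2) ℂ) rF β L (fun U => Real.exp ((R : ℝ) ^ 4 / C₁ * |k U - K1|)) ≤ Real.exp B := by
    have e : (fun U => Real.exp ((R : ℝ) ^ 4 / C₁ * |k U - K1|)) = (fun U => Real.exp ((R : ℝ) ^ 4 / C₁ * (K1 - k U))) :=
      funext fun U => by rw [hpt U]
    rw [e]
    exact hX1
  have h2 : torusE (Matrix.specialUnitaryGroup (Fin 2) ℂ) rF β L (fun U => |k U - K1|) ≤ (Real.exp B - 1) / ((R : ℝ) ^ 4 / C₁) :=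
    torusE_abs_sub_le_of_expMoment rF β L hkc hlam (p := K1) (B := B) h1
  have h3 : (Real.exp B - 1) / ((R : ℝ) ^ 4 / C₁) = C₁ * (Real.exp B - 1) / (R : ℝ) ^ 4 := by
    field_simp
  rw [h3] at h2
  -- the derived reference value is the torus mean of `k` (DLR + translation invariance)
  have hp : pRef ℓ₁ q β = torusE (Matrix.specialUnitaryGroup (Fin 2) ℂ) rF β L k := by
    show torusE (Matrix.specialUnitaryGroup (Fin 2) ℂ) rF β L (plane (Matrix.specialUnitaryGroup (Fin 2) ℂ) rF q 0) = _
    rw [torusE_plane_eq_wilsonTorusMean rF β L q 0, ← torusE_plane_eq_wilsonTorusMean rF β L q x,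
      torusE_plane_eq_torusE_kerE rF β q x R L (by omega)]
  have h4 : torusE (Matrix.specialUnitaryGroup (Fin 2) ℂ) rF β L k - K1 =
      torusE (Matrix.specialUnitaryGroup (Fin 2) ℂ) rF β L (fun U => k U - K1) := by
    rw [show (fun U => k U - K1) = (fun U => k U + -K1) from funext fun _ => sub_eq_add_neg _ _,
      torusE_add' rF β L hkc continuous_const, torusE_const]
    ring
  rw [abs_sub_comm, hp, h4]
  unfold torusE at h2 ⊢
  exact (MeasureTheory.abs_integral_le_integral_abs).trans h2

/-- The derived reference values are bounded (a torus mean of a bounded continuous observable). -/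
theorem abs_pRef_le (ℓ₁ : ℝ) : ∃ P₀ : ℝ, ∀ q β, |pRef ℓ₁ q β| ≤ P₀ := by
  letI : MeasurableSpace (Matrix.specialUnitaryGroup (Fin 2) ℂ) := borel _
  haveI : BorelSpace (Matrix.specialUnitaryGroup (Fin 2) ℂ) := ⟨rfl⟩
  obtain ⟨CA, hCA⟩ := exists_abs_plane_le (G := Matrix.specialUnitaryGroup (Fin 2) ℂ) rF
  refine ⟨CA, fun q β => ?_⟩
  have h := abs_torusE_sub_le_of_forall rF β (Ldag ℓ₁ β) (continuous_plane rF q 0) (c := 0) (h := CA)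
    (fun U => by rw [sub_zero]; exact hCA q 0 U)
  simpa [pRef, sub_zero] using h

/-- GLUE (proved here): (CWX) ∧ (XM) ⇒ the registered v5(α) (RM) body, with the DERIVED reference `pRef ℓ₁`, unit `a := uRec`, `c := 1`,
`β₁ := max β₀ β₁`, `ℓ₁ := min ℓ₀ ℓ₁`, `B ↦ B + (e^B − 1)`.  Mechanism: pointwise `|kerE^U − kerE^𝟙| = kerE^𝟙 − kerE^U` (CWX), so (XM) IS the cold-wall-centred
absolute moment bound; `coldWall_pin` moves the centre to `pRef` at cost `exp((e^B − 1)·#T)` (`torusE_exp_sum_response_recentre`). -/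
theorem responseMomentsOdd6SU2_of_extremal
    (hCW : ∃ (β₀ ℓ₀ : ℝ), 0 < ℓ₀ ∧
      ∀ β : ℝ, β₀ ≤ β → ∀ R : ℕ, 1 ≤ R → (R : ℝ) * Transport.uRec β ≤ ℓ₀ →
      ∀ (q : Fin 4 × Fin 4) (x : Fin 4 → ℤ), q.1 < q.2 → ∀ η : LGConfig 4 (Matrix.specialUnitaryGroup (Fin 2) ℂ),
        kerE (Matrix.specialUnitaryGroup (Fin 2) ℂ) (fundamentalLatticeRep 2) β (fun k => x k - (R + 1)) (2 * R + 3) η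
            (plane (Matrix.specialUnitaryGroup (Fin 2) ℂ) (fundamentalLatticeRep 2) q x) ≤
          kerE (Matrix.specialUnitaryGroup (Fin 2) ℂ) (fundamentalLatticeRep 2) β (fun k => x k - (R + 1)) (2 * R + 3) 1
            (plane (Matrix.specialUnitaryGroup (Fin 2) ℂ) (fundamentalLatticeRep 2) q x))
    (hXM : letI : MeasurableSpace (Matrix.specialUnitaryGroup (Fin 2) ℂ) := borel _
      haveI : BorelSpace (Matrix.specialUnitaryGroup (Fin 2) ℂ) := ⟨rfl⟩
      ∃ (C₁ B β₁ ℓ₁ : ℝ), 0 < C₁ ∧ 0 < ℓ₁ ∧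
      ∀ β : ℝ, β₁ ≤ β → ∀ (L n : ℕ) (q : Fin n → Fin 4 × Fin 4) (x : Fin n → (Fin 4 → ℤ)) (R : ℕ),
      (∀ i, (q i).1 < (q i).2) → 1 ≤ R → (R : ℝ) * Transport.uRec β ≤ ℓ₁ → 4 * R + 8 ≤ L →
      (∀ i j : Fin n, i ≠ j → ∃ k : Fin 4,
        (2 * (R : ℤ) + 4) ≤ |((((x i k - x j k : ℤ) : ZMod (2 * L + 1))).valMinAbs : ℤ)|) →
      ∀ T : Finset (Fin n),
        torusE (Matrix.specialUnitaryGroup (Fin 2) ℂ) (fundamentalLatticeRep 2) β L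
          (fun U => Real.exp (∑ i ∈ T, (R : ℝ) ^ 4 / C₁ *
            (kerE (Matrix.specialUnitaryGroup (Fin 2) ℂ) (fundamentalLatticeRep 2) β (fun k => x i k - (R + 1)) (2 * R + 3) 1
                (plane (Matrix.specialUnitaryGroup (Fin 2) ℂ) (fundamentalLatticeRep 2) (q i) (x i)) -
              kerE (Matrix.specialUnitaryGroup (Fin 2) ℂ) (fundamentalLatticeRep 2) β (fun k => x i k - (R + 1)) (2 * R + 3) U
                (plane (Matrix.specialUnitaryGroup (Fin 2) ℂ) (fundamentalLatticeRep 2) (q i) (x i))))) ≤ Real.exp (B * T.card)) :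
    letI : MeasurableSpace (Matrix.specialUnitaryGroup (Fin 2) ℂ) := borel _
    haveI : BorelSpace (Matrix.specialUnitaryGroup (Fin 2) ℂ) := ⟨rfl⟩
    ∃ (a : ℝ → ℝ) (c : ℝ) (C₁ B β₁ ℓ₁ P₀ : ℝ) (p : Fin 4 × Fin 4 → ℝ → ℝ), 0 < c ∧
      (∀ᶠ β in atTop, a β ≤ c * Transport.uRec β) ∧ 0 < ℓ₁ ∧ 0 < C₁ ∧ (∀ q β, |p q β| ≤ P₀) ∧
      ∀ β : ℝ, β₁ ≤ β → ∀ (L n : ℕ) (q : Fin n → Fin 4 × Fin 4) (x : Fin n → (Fin 4 → ℤ)) (R : ℕ),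
        (∀ i, (q i).1 < (q i).2) → 1 ≤ R → (R : ℝ) * a β ≤ ℓ₁ → 4 * R + 8 ≤ L →
        (∀ i j : Fin n, i ≠ j → ∃ k : Fin 4,
          (2 * (R : ℤ) + 4) ≤ |((((x i k - x j k : ℤ) : ZMod (2 * L + 1))).valMinAbs : ℤ)|) →
        ∀ T : Finset (Fin n),
          torusE (Matrix.specialUnitaryGroup (Fin 2) ℂ) (fundamentalLatticeRep 2) β L
            (fun U => Real.exp (∑ i ∈ T, (R : ℝ) ^ 4 / C₁ *
              |kerE (Matrix.specialUnitaryGroup (Fin 2) ℂ) (fundamentalLatticeRep 2) β (fun k => x i k - (R + 1)) (2 * R + 3) U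
                (plane (Matrix.specialUnitaryGroup (Fin 2) ℂ) (fundamentalLatticeRep 2) (q i) (x i)) - p (q i) β|)) ≤ Real.exp (B * T.card) := by
  letI : MeasurableSpace (Matrix.specialUnitaryGroup (Fin 2) ℂ) := borel _
  haveI : BorelSpace (Matrix.specialUnitaryGroup (Fin 2) ℂ) := ⟨rfl⟩
  obtain ⟨β₀, ℓ₀, hℓ₀, hCW⟩ := hCW
  obtain ⟨C₁, B, β₁, ℓ₁, hC₁, hℓ₁, hXM⟩ := hXM
  obtain ⟨P₀, hP₀⟩ := abs_pRef_le ℓ₁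
  refine ⟨Transport.uRec, 1, C₁, B + (Real.exp B - 1), max β₀ β₁, min ℓ₀ ℓ₁, P₀, pRef ℓ₁, one_pos,
    Filter.Eventually.of_forall fun β => by rw [one_mul], lt_min hℓ₀ hℓ₁, hC₁, hP₀, ?_⟩
  intro β hβ L n q x R hq hR hRa hL hsep T
  have hβ0 : β₀ ≤ β := (le_max_left _ _).trans hβ
  have hβ1 : β₁ ≤ β := (le_max_right _ _).trans hβ
  have hRa0 : (R : ℝ) * Transport.uRec β ≤ ℓ₀ := hRa.trans (min_le_left _ _)
  have hRa1 : (R : ℝ) * Transport.uRec β ≤ ℓ₁ := hRa.trans (min_le_right _ _)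
  have hR0 : (0 : ℝ) < R := by exact_mod_cast (show 0 < R by omega)
  -- cold-wall kernel means (the deterministic centring)
  set K1 : Fin n → ℝ := fun i =>
    kerE (Matrix.specialUnitaryGroup (Fin 2) ℂ) (fundamentalLatticeRep 2) β (fun k => x i k - (R + 1)) (2 * R + 3) 1
      (plane (Matrix.specialUnitaryGroup (Fin 2) ℂ) (fundamentalLatticeRep 2) (q i) (x i)) with hK1
  -- (XM) is the cold-wall-centred absolute moment bound, by the sign (CWX)
  have hmom : torusE (Matrix.specialUnitaryGroup (Fin 2) ℂ) (fundamentalLatticeRep 2) β L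
      (fun U => Real.exp (∑ i ∈ T, (R : ℝ) ^ 4 / C₁ *
        |kerE (Matrix.specialUnitaryGroup (Fin 2) ℂ) (fundamentalLatticeRep 2) β (fun k => x i k - (R + 1)) (2 * R + 3) U
            (plane (Matrix.specialUnitaryGroup (Fin 2) ℂ) (fundamentalLatticeRep 2) (q i) (x i)) - K1 i|)) ≤ Real.exp (B * T.card) := by
    have e : (fun U : LGConfig 4 (Matrix.specialUnitaryGroup (Fin 2) ℂ) => Real.exp (∑ i ∈ T, (R : ℝ) ^ 4 / C₁ *
        |kerE (Matrix.specialUnitaryGroup (Fin 2) ℂ) (fundamentalLatticeRep 2) β (fun k => x i k - (R + 1)) (2 * R + 3) U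
            (plane (Matrix.specialUnitaryGroup (Fin 2) ℂ) (fundamentalLatticeRep 2) (q i) (x i)) - K1 i|)) =
        (fun U => Real.exp (∑ i ∈ T, (R : ℝ) ^ 4 / C₁ *
          (kerE (Matrix.specialUnitaryGroup (Fin 2) ℂ) (fundamentalLatticeRep 2) β (fun k => x i k - (R + 1)) (2 * R + 3) 1
              (plane (Matrix.specialUnitaryGroup (Fin 2) ℂ) (fundamentalLatticeRep 2) (q i) (x i)) -
            kerE (Matrix.specialUnitaryGroup (Fin 2) ℂ) (fundamentalLatticeRep 2) β (fun k => x i k - (R + 1)) (2 * R + 3) U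
              (plane (Matrix.specialUnitaryGroup (Fin 2) ℂ) (fundamentalLatticeRep 2) (q i) (x i))))) := by
      funext U
      refine congrArg Real.exp (Finset.sum_congr rfl fun i _ => ?_)
      rw [abs_sub_comm, abs_of_nonneg (sub_nonneg.2 (hCW β hβ0 R hR hRa0 (q i) (x i) (hq i) U))]
    rw [e]
    exact hXM β hβ1 L n q x R hq hR hRa1 hL hsep T
  -- pinning of the derived reference to each cold-wall mean
  have hpin : ∀ i ∈ T, |K1 i - pRef ℓ₁ (q i) β| ≤ C₁ * (Real.exp B - 1) / (R : ℝ) ^ 4 := by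
    intro i _
    have h1 := hXM β hβ1 (Ldag ℓ₁ β) 1 (fun _ => q i) (fun _ => x i) R (fun _ => hq i) hR hRa1 (le_Ldag hRa1)
      (fun i' j' hij => absurd (Subsingleton.elim i' j') hij) Finset.univ
    simp only [Finset.univ_unique, Finset.sum_singleton, Finset.card_singleton, Nat.cast_one, mul_one] at h1
    exact coldWall_pin hC₁ hR hRa1 (q i) (x i) (fun η => hCW β hβ0 R hR hRa0 (q i) (x i) (hq i) η) h1
  -- recentre
  have hrec := torusE_exp_sum_response_recentre rF β L T q x R hC₁ K1 (fun i => pRef ℓ₁ (q i) β) hpin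
  refine hrec.trans ?_
  have hfac : Real.exp ((R : ℝ) ^ 4 / C₁ * (C₁ * (Real.exp B - 1) / (R : ℝ) ^ 4) * T.card) = Real.exp ((Real.exp B - 1) * T.card) := by
    congr 1
    field_simp
  rw [hfac]
  calc Real.exp ((Real.exp B - 1) * T.card) * torusE (Matrix.specialUnitaryGroup (Fin 2) ℂ) rF β L
        (fun U => Real.exp (∑ i ∈ T, (R : ℝ) ^ 4 / C₁ *
          |kerE (Matrix.specialUnitaryGroup (Fin 2) ℂ) rF β (fun k => x i k - (R + 1)) (2 * R + 3) U
              (plane (Matrix.specialUnitaryGroup (Fin 2) ℂ) rF (q i) (x i)) - K1 i|))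
      ≤ Real.exp ((Real.exp B - 1) * T.card) * Real.exp (B * T.card) :=
        mul_le_mul_of_nonneg_left hmom (Real.exp_pos _).le
    _ = Real.exp ((B + (Real.exp B - 1)) * T.card) := by rw [← Real.exp_add]; ring_nf

/-- (RM) — a THEOREM of the skeleton: the registered v5(α) text of `stub_responseMomentsOdd6` VERBATIM (`UV →` kept because it is the registered text;
the hypothesis is not consumed), from (CWX) ∧ (XM) through `responseMomentsOdd6SU2_of_extremal`. -/
theorem stub_responseMomentsOdd6 :
    Summit.QuantumFields.YangMills.Theses.BalabanLadder.UV →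
      letI : MeasurableSpace (Matrix.specialUnitaryGroup (Fin 2) ℂ) := borel _
      haveI : BorelSpace (Matrix.specialUnitaryGroup (Fin 2) ℂ) := ⟨rfl⟩
      ∃ (a : ℝ → ℝ) (c : ℝ) (C₁ B β₁ ℓ₁ P₀ : ℝ) (p : Fin 4 × Fin 4 → ℝ → ℝ), 0 < c ∧
      (∀ᶠ β in atTop, a β ≤ c * Transport.uRec β) ∧ 0 < ℓ₁ ∧ 0 < C₁ ∧ (∀ q β, |p q β| ≤ P₀) ∧
      ∀ β : ℝ, β₁ ≤ β → ∀ (L n : ℕ) (q : Fin n → Fin 4 × Fin 4) (x : Fin n → (Fin 4 → ℤ)) (R : ℕ),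
      (∀ i, (q i).1 < (q i).2) → 1 ≤ R → (R : ℝ) * a β ≤ ℓ₁ → 4 * R + 8 ≤ L →
      (∀ i j : Fin n, i ≠ j → ∃ k : Fin 4,
      (2 * (R : ℤ) + 4) ≤ |((((x i k - x j k : ℤ) : ZMod (2 * L + 1))).valMinAbs : ℤ)|) →
      ∀ T : Finset (Fin n),
      torusE (Matrix.specialUnitaryGroup (Fin 2) ℂ) (Literature.MathematicalPhysics.QuantumLattice.fundamentalLatticeRep 2) β L
      (fun U => Real.exp (∑ i ∈ T, (R : ℝ) ^ 4 / C₁ *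
      |kerE (Matrix.specialUnitaryGroup (Fin 2) ℂ) (Literature.MathematicalPhysics.QuantumLattice.fundamentalLatticeRep 2) β
      (fun k => x i k - (R + 1)) (2 * R + 3) U
      (plane (Matrix.specialUnitaryGroup (Fin 2) ℂ) (Literature.MathematicalPhysics.QuantumLattice.fundamentalLatticeRep 2) (q i) (x i)) -
      p (q i) β|)) ≤ Real.exp (B * T.card) :=
  fun _ => responseMomentsOdd6SU2_of_extremal stub_coldWallExtremal stub_defectMoments

/-- E0′ ceilings — a THEOREM of the skeleton (as v5(α)): (RM) through the landed press-button `TemperedResponse.stubCeilings_of_responseMoments`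
(p532738).  Statement = v4-F's `stub_ceilings` VERBATIM. -/
theorem stub_ceilings :
    Summit.QuantumFields.YangMills.Theses.BalabanLadder.UV →
      letI : MeasurableSpace (Matrix.specialUnitaryGroup (Fin 2) ℂ) := borel _
      haveI : BorelSpace (Matrix.specialUnitaryGroup (Fin 2) ℂ) := ⟨rfl⟩
      MomentBounds6 (Matrix.specialUnitaryGroup (Fin 2) ℂ) rF uRec :=
  fun hUV => Summit.QuantumFields.YangMills.Cruxes.UVSeamRec.TemperedResponse.stubCeilings_of_responseMoments
    (stub_responseMomentsOdd6 hUV)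

/-- STUB F-B∧F-C «compact-witness floors at an asymptotically-two-loop engine unit» (XL; NO `UV`; BYTE-IDENTICAL to v5(α)/v7c/v8c/v8d/coldwall_pure; = the engine
data of the landed per-representation transfer `UnitTransfer.lowerBounds_uRec_of_engine rF`, p441552): the FUNDAMENTAL representation `rF` of `SU(2)` and
a unit map `a` with `a β / uRec β → c₀ > 0` carrying the `Q2`/`Q3` floors with COMPACTLY SUPPORTED witnesses.  Supplier: the NT line's conditional femto
package at `SU(2)`-fundamental (19353 `stub_cfp : CFP` engine E1–E3; landed discharge `FloorsEngineOfWindow.floorsEngine_of_fcp_commensurable rF a …`,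
p448741).  NOT rescued by this line (its rescue is a line on 19353).  Why it might fail: as NT (19353) — a β-uniform floor is dimensional transmutation
(barrier PerturbativeInvisibility) — plus the scaling of the non-perturbative unit (Patrascioiu–Seiler vs. consensus). -/
theorem stub_floorsEngine :
    letI : MeasurableSpace (Matrix.specialUnitaryGroup (Fin 2) ℂ) := borel _
    haveI : BorelSpace (Matrix.specialUnitaryGroup (Fin 2) ℂ) := ⟨rfl⟩
    ∃ (a : ℝ → ℝ) (c₀ : ℝ), 0 < c₀ ∧ (∀ β, 0 < a β) ∧
      Tendsto (fun β => a β / uRec β) atTop (𝓝 c₀) ∧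
      (∃ (v : 𝓢(EuclideanSpace ℝ (Fin 4), ℝ)) (ε β₅ Λ₅ : ℝ),
        HasCompactSupport (v : EuclideanSpace ℝ (Fin 4) → ℝ) ∧
        tsupport (v : EuclideanSpace ℝ (Fin 4) → ℝ) ⊆ {y : EuclideanSpace ℝ (Fin 4) | 0 < y 0} ∧ 0 < ε ∧
        ∀ β : ℝ, β₅ ≤ β → ∀ L : ℕ, Λ₅ ≤ a β * L →
          ε ≤ Q2 (Matrix.specialUnitaryGroup (Fin 2) ℂ) rF β L (a β) (thetaTest 4 v) v) ∧
      (∃ (f g h : 𝓢(EuclideanSpace ℝ (Fin 4), ℝ)) (ε β₅ Λ₅ : ℝ),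
        HasCompactSupport (f : EuclideanSpace ℝ (Fin 4) → ℝ) ∧
        HasCompactSupport (g : EuclideanSpace ℝ (Fin 4) → ℝ) ∧
        HasCompactSupport (h : EuclideanSpace ℝ (Fin 4) → ℝ) ∧
        Disjoint (tsupport (f : EuclideanSpace ℝ (Fin 4) → ℝ)) (tsupport (g : EuclideanSpace ℝ (Fin 4) → ℝ)) ∧
        Disjoint (tsupport (g : EuclideanSpace ℝ (Fin 4) → ℝ)) (tsupport (h : EuclideanSpace ℝ (Fin 4) → ℝ)) ∧
        Disjoint (tsupport (f : EuclideanSpace ℝ (Fin 4) → ℝ)) (tsupport (h : EuclideanSpace ℝ (Fin 4) → ℝ)) ∧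
        0 < ε ∧ ∀ β : ℝ, β₅ ≤ β → ∀ L : ℕ, Λ₅ ≤ a β * L →
          ε ≤ |Q3 (Matrix.specialUnitaryGroup (Fin 2) ℂ) rF β L (a β) f g h|) := by
  sorry

/-- COMPOSITION (kernel-checked, closed form): ceilings ⊕ engine floors ⊕ LANDED unit transfer ⊕ transport ⇒ the item BY NAME. -/
theorem UVSeamRec_of : Summit.QuantumFields.YangMills.Theses.BalabanLadder.UVSeamRec := by
  intro hUV G _ _ _ _ hG hcl
  letI : MeasurableSpace (Matrix.specialUnitaryGroup (Fin 2) ℂ) := borel _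
  haveI : BorelSpace (Matrix.specialUnitaryGroup (Fin 2) ℂ) := ⟨rfl⟩
  have hc := stub_ceilings hUV
  obtain ⟨a, c₀, hc₀, ha, hau, h2, h3⟩ := stub_floorsEngine
  have hlb := Summit.QuantumFields.YangMills.Cruxes.UVSeamRec.UnitTransfer.lowerBounds_uRec_of_engine rF hc₀ ha hau hc h2 h3
  exact stub_transport ⟨rF, hlb, hc⟩ G hG hcl

end Summit.QuantumFields.YangMills.Cruxes.UVSeamRec.ExtremalColdWall
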